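import Literature.MathematicalPhysics.QuantumManyBody.PeriodicBoseGasJastrow
import Literature.MathematicalPhysics.QuantumManyBody.PeriodicBoseGasScattering
import HarnessLib

/-!
# The Jastrow (pair-product) infimum of the periodic Bose gas

Topic `Literature/MathematicalPhysics/QuantumManyBody`, sibling of `PeriodicBoseGasJastrow.lean`.
The **Jastrow ground-state energy** `E_J(N, L)` of `N` bosons on the torus of side `L` with pair
interaction `v` is the infimum of the periodic quadratic form `⟨Ψ, HΨ⟩` (`periodicEnergy`) over
the *pair-product (Bijl–Dingle–Jastrow) manifold* `{Ψ_φ = ∏_{i<j} Φ(xᵢ - xⱼ)/‖·‖}`, `φ` a pair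
profile with cut-off `b`, `2b < L`, `Φ = φ ∘ (reduction to the nearest lattice point)` — exactly
the normalised product trial states `IsPairProfile.trialState` of the in-tree proof of
[LSSY2005, Thm. 2.2]. Dyson [Dyson1957] and LSSY [(2.15)–(2.18), remark after (2.17)] use the
nearest-neighbour variant of the ansatz; the symmetric product over all pairs is the trial state
of [BastiEtAl2024, §2 (2.1)] and [BastiEtAl2026, (1.5)–(1.11)], where the leading-order bound
(1.10)–(1.11) is computed for it and the question whether the pure pair-product class resolves
the Lee–Huang–Yang correction is raised (pp. 4–5).

## Contents

* `jastrowGroundStateEnergy v N L`: the `iInf` of `periodicEnergy v (hφ.trialState hL hbL hν)`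
  over `(hL : 0 < L) (b : ℝ) (φ : ℝ³ → ℝ) (hφ : IsPairProfile b φ) (hbL : 2b < L) (hν : 0 < ‖Ψ‖²)`
  — literally the `iInf` inlined in the route items that requested the notion (they unfold to it
  by `rfl`); the variational principle on the manifold, `E₀^per(N, L) ≤ E_J(N, L)`, `E_J = ⊤` for
  `L ≤ 0`, and the `le_iInf` characterisation.
* `IsPairProfile.periodicEnergy_trialState_le`: the product-state bound **for the trial state**,
  `⟨Ψ_φ, HΨ_φ⟩ ≤ N(N-1)/2 · E/(L³-(N-1)I') + N(N-1)(N-2) K'²/(L³-(N-1)I')²` under the hypotheses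
  of `LSSY2005_jastrowBound` [LSSY2005, Thm. 2.2, proof, (2.19)–(2.31)]. The in-tree
  `LSSY2005_jastrowBound_holds` proves exactly this and ends with the variational principle; its
  assembly is repeated verbatim without that last line (the analytic lemmas are imported from
  `PeriodicBoseGasJastrow.lean`). Hence the same bound for `E_J(N, L)`
  (`jastrowGroundStateEnergy_le_pairBound`), of which `LSSY2005_jastrowBound` is the composite
  with `E₀^per ≤ E_J`.
* `jastrowGroundStateEnergy_le_leadingOrder`: **LSSY (2.14) for the Jastrow infimum** — for
  finite-range `v` with `a < ∞` there are `C, c > 0` (`C = 12`) with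
  `E_J(N, L) ≤ 4πρ₁a(1 + C a/b)N` for `N ≥ 2`, `L > 0`, `a/b ≤ c` (`ρ₁ = (N-1)/L³`,
  `b = (4πρ₁/3)^{-1/3}`) [LSSY2005, Thm. 2.2 (2.14); BastiEtAl2026 (1.10)–(1.11)]: the printed
  proof bounds the energy of the trial state, hence the infimum over the manifold. Proof: steps 1
  and 3 of `PeriodicBoseGasUpperBound.lean` (`LSSY2005_dysonProfile_holds`,
  `LSSY2005_zeroScatteringLength_holds`, `jastrow_optimisation`) with the pair bound as step 2.
  Corollaries: `E_J < ⊤` in the dilute regime (non-vacuity of hypotheses `⟨Ψ_φ, HΨ_φ⟩ ≤ E_J + δ`)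
  and `E_J = 0` for `v = 0`.

Not here: optimal or near-optimal pair factors (Euler–Lagrange equations, tails, condensation of
Jastrow states), the thermodynamic limit of `E_J/N`, second-order bounds.

## References

* [LSSY2005] E. H. Lieb, R. Seiringer, J. P. Solovej, J. Yngvason, *The Mathematics of the Bose
  Gas and its Condensation*, Oberwolfach Seminars 34, Birkhäuser 2005, arXiv:cond-mat/0610117:
  Thm. 2.2 (2.14) and its proof (2.15)–(2.33), pp. 12–13.
* [Dyson1957] F. J. Dyson, *Ground-state energy of a hard-sphere gas*, Phys. Rev. 106 (1957).
* [BastiEtAl2024] G. Basti, S. Cenatiempo, A. Giuliani, A. Olgiati, G. Pasqualetti, B. Schlein,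
  *Upper bound for the ground state energy of a dilute Bose gas of hard spheres*, Arch. Ration.
  Mech. Anal. 248 (2024), arXiv:2212.04431: §2 (2.1).
* [BastiEtAl2026] G. Basti, M. Brooks, S. Cenatiempo, A. Olgiati, B. Schlein, *The Lee–Huang–Yang
  energy for a dilute gas of hard spheres: an upper bound*, arXiv:2603.13084: (1.5)–(1.11),
  pp. 4–5.
-/

noncomputable section

open MeasureTheory Filter Topology Set
open scoped ENNReal NNReal

namespace Literature.MathematicalPhysics.QuantumManyBody.BoseGas

/-! ### The Jastrow infimum -/

/-- The **Jastrow (pair-product) ground-state energy** `E_J(N, L) ∈ [0, ∞]` of `N` bosons on the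
torus of side `L` with pair interaction `v`: the infimum of the periodic energy `⟨Ψ, HΨ⟩` over the
normalised product states `Ψ = ∏_{i<j} Φ(xᵢ - xⱼ)/‖·‖`, `Φ = φ ∘ reduce L`, of all pair profiles
`φ` (`C¹`, even, `0 ≤ φ ≤ 1`, `φ = 1` off the ball of radius `b`) with `2b < L` — the trial states
`IsPairProfile.trialState` of the proof of LSSY Thm. 2.2, in the symmetric variant
`∏_{i<j} f(|xᵢ - xⱼ|)` of the remark after (2.17) (the Bijl–Dingle–Jastrow factor of
BastiEtAl2024 (2.1), BastiEtAl2026 (1.5)). The index `hν : 0 < ‖Ψ‖²` is the normalisability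
datum of `trialState` (it holds whenever `(N-1)∫(1-φ²) < L³`, `IsPairProfile.jastrowNormR_pos`);
`E_J(N, L) = ⊤` for `L ≤ 0`. By the variational principle `E₀^per(N, L) ≤ E_J(N, L)`.
[cite: LSSY2005, Thm. 2.2, proof, (2.15)–(2.18)] -/
def jastrowGroundStateEnergy (v : ℝ → ℝ≥0∞) (N : ℕ) (L : ℝ) : ℝ≥0∞ :=
  ⨅ (hL : 0 < L) (b : ℝ) (φ : Space → ℝ) (hφ : IsPairProfile b φ) (hbL : 2 * b < L)
    (hν : 0 < jastrowNormR L φ (Finset.univ : Finset (Fin N))),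
    periodicEnergy v (hφ.trialState hL hbL hν)

/-- Unfolding of `jastrowGroundStateEnergy` (by `rfl`). [folklore] -/
theorem jastrowGroundStateEnergy_def (v : ℝ → ℝ≥0∞) (N : ℕ) (L : ℝ) :
    jastrowGroundStateEnergy v N L =
      ⨅ (hL : 0 < L) (b : ℝ) (φ : Space → ℝ) (hφ : IsPairProfile b φ) (hbL : 2 * b < L)
        (hν : 0 < jastrowNormR L φ (Finset.univ : Finset (Fin N))),
        periodicEnergy v (hφ.trialState hL hbL hν) :=
  rfl

/-- **Variational principle on the pair-product manifold**: the Jastrow infimum is below the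
energy of every Jastrow trial state. [folklore] -/
theorem jastrowGroundStateEnergy_le (v : ℝ → ℝ≥0∞) {N : ℕ} {L b : ℝ} {φ : Space → ℝ}
    (hφ : IsPairProfile b φ) (hL : 0 < L) (hbL : 2 * b < L)
    (hν : 0 < jastrowNormR L φ (Finset.univ : Finset (Fin N))) :
    jastrowGroundStateEnergy v N L ≤ periodicEnergy v (hφ.trialState hL hbL hν) :=
  iInf_le_of_le hL <| iInf_le_of_le b <| iInf_le_of_le φ <| iInf_le_of_le hφ <|
    iInf_le_of_le hbL <| iInf_le _ hν

/-- Lower bounds for the Jastrow infimum are exactly the uniform lower bounds for the energies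
of the Jastrow trial states. [folklore] -/
theorem le_jastrowGroundStateEnergy_iff {v : ℝ → ℝ≥0∞} {N : ℕ} {L : ℝ} {E : ℝ≥0∞} :
    E ≤ jastrowGroundStateEnergy v N L ↔
      ∀ (hL : 0 < L) (b : ℝ) (φ : Space → ℝ) (hφ : IsPairProfile b φ) (hbL : 2 * b < L)
        (hν : 0 < jastrowNormR L φ (Finset.univ : Finset (Fin N))),
        E ≤ periodicEnergy v (hφ.trialState hL hbL hν) := by
  simp only [jastrowGroundStateEnergy, le_iInf_iff]

/-- **`E₀^per(N, L) ≤ E_J(N, L)`**: every Jastrow trial state is an admissible periodic trial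
state (variational principle). [cite: LSSY2005, Thm. 2.2, proof, first paragraph and (2.26)] -/
theorem periodicGroundStateEnergy_le_jastrowGroundStateEnergy (v : ℝ → ℝ≥0∞) (N : ℕ) (L : ℝ) :
    periodicGroundStateEnergy v N L ≤ jastrowGroundStateEnergy v N L :=
  le_jastrowGroundStateEnergy_iff.mpr fun hL _ _ hφ hbL hν =>
    periodicGroundStateEnergy_le v (hφ.trialState hL hbL hν)

/-- There are no Jastrow trial states on a degenerate torus: `E_J(N, L) = ⊤` for `L ≤ 0`.
[folklore] -/
theorem jastrowGroundStateEnergy_of_nonpos (v : ℝ → ℝ≥0∞) (N : ℕ) {L : ℝ} (hL : L ≤ 0) :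
    jastrowGroundStateEnergy v N L = ⊤ := by
  rw [jastrowGroundStateEnergy, iInf_neg (not_lt.mpr hL)]

/-! ### The product-state bound for the trial state and for the Jastrow infimum -/

section PairBound

open Finset

/-- **LSSY 2005, proof of Thm. 2.2, step 2, for the trial state itself.** Let `v ≥ 0` be
measurable, `N ≥ 2`, `L > 0`, and let `φ` be a pair profile with cut-off `b`, `2b < L`. If
`E₁ = 2𝓔[φ] ≤ E`, `I = ∫(1-φ²) ≤ I'`, `K = ∫ φ|∇φ| ≤ K'` and `(N-1)I' < L³`, then the normalised
product state `Ψ_φ = ∏_{i<j} Φ(xᵢ - xⱼ)/‖·‖` satisfies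
`⟨Ψ_φ, HΨ_φ⟩ ≤ N(N-1)/2 · E/(L³-(N-1)I') + N(N-1)(N-2) K'²/(L³-(N-1)I')²`.
This is the content of the printed proof [(2.19)–(2.31)] (pointwise kinetic bound, `v^per Φ² ≤
(vφ²)^per`, one-particle elimination `∫Ψ² ≥ (L³-(N-1)I')∫Ψᵢ²/L³`, unfolding of the periodised
one-body integrals), whose in-tree form `LSSY2005_jastrowBound_holds` ends with the variational
principle; the assembly below is that proof verbatim without its last line.
[cite: LSSY2005, Thm. 2.2, proof, (2.19)–(2.31)] -/
theorem IsPairProfile.periodicEnergy_trialState_le {v : ℝ → ℝ≥0∞} (hv : Measurable v) {N : ℕ}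
    {L b : ℝ} (hN : 2 ≤ N) (hL : 0 < L) (hbL : 2 * b < L) {φ : Space → ℝ}
    (hφ : IsPairProfile b φ) {E I K : ℝ} (hE0 : 0 ≤ E) (hI0 : 0 ≤ I) (hK0 : 0 ≤ K)
    (hE : profileEnergy v φ ≤ ENNReal.ofReal E) (hI : profileDefect φ ≤ ENNReal.ofReal I)
    (hK : profileK φ ≤ ENNReal.ofReal K) (hNI : ((N : ℝ) - 1) * I < L ^ 3)
    (hν0 : 0 < jastrowNormR L φ (univ : Finset (Fin N))) :
    periodicEnergy v (hφ.trialState hL hbL hν0) ≤ ENNReal.ofReal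
      (N * ((N : ℝ) - 1) / 2 * E / (L ^ 3 - ((N : ℝ) - 1) * I) +
        N * ((N : ℝ) - 1) * ((N : ℝ) - 2) * K ^ 2 / (L ^ 3 - ((N : ℝ) - 1) * I) ^ 2) := by
  classical
  -- real parameters
  have hN2 : (2 : ℝ) ≤ N := by exact_mod_cast hN
  have hN1 : 1 ≤ N := by omega
  have hL3 : 0 < L ^ 3 := by positivity
  have hden : 0 < L ^ 3 - ((N : ℝ) - 1) * I := by linarith
  set D : ℝ := L ^ 3 / (L ^ 3 - ((N : ℝ) - 1) * I) with hD
  have hD0 : 0 < D := div_pos hL3 hden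
  set ν := jastrowNormR L φ (univ : Finset (Fin N)) with hν
  -- norms of the states with one or two particles eliminated
  have hn1 : ∀ k : Fin N, jastrowNormSq L φ (univ.erase k) ≤ ENNReal.ofReal (D * ν) := by
    intro k
    rw [← hφ.ofReal_jastrowNormR]
    exact ENNReal.ofReal_le_ofReal (hφ.jastrowNormR_erase_le' hL hbL hI0 hI hNI univ (mem_univ k))
  have hn2 : ∀ i j : Fin N, j ≠ i →
      jastrowNormSq L φ ((univ.erase i).erase j) ≤ ENNReal.ofReal (D ^ 2 * ν) := by
    intro i j hji
    rw [← hφ.ofReal_jastrowNormR]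
    refine ENNReal.ofReal_le_ofReal ?_
    have h1 := hφ.jastrowNormR_erase_le' hL hbL hI0 hI hNI (univ.erase i)
      (mem_erase.mpr ⟨hji, mem_univ j⟩)
    have h2 := hφ.jastrowNormR_erase_le' hL hbL hI0 hI hNI univ (mem_univ i)
    calc jastrowNormR L φ ((univ.erase i).erase j) ≤ D * jastrowNormR L φ (univ.erase i) := h1
      _ ≤ D * (D * ν) := mul_le_mul_of_nonneg_left h2 hD0.le
      _ = D ^ 2 * ν := by ring
  -- the one-body integrals of the profile, as real numbers
  set G := ∫⁻ x, gradSq φ x with hG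
  set P := ∫⁻ x, v ‖x‖ * ENNReal.ofReal (φ x ^ 2) with hP
  have hGP : 2 * G + P = profileEnergy v φ := (profileEnergy_eq hφ.contDiff).symm
  have hGP' : 2 * G + P ≤ ENNReal.ofReal E := hGP ▸ hE
  have hGtop : G ≠ ⊤ := by
    refine ne_top_of_le_ne_top ENNReal.ofReal_ne_top ((le_trans ?_ le_self_add).trans hGP')
    rw [two_mul]; exact le_self_add
  have hPtop : P ≠ ⊤ := ne_top_of_le_ne_top ENNReal.ofReal_ne_top (le_add_self.trans hGP')
  have hKtop : profileK φ ≠ ⊤ := ne_top_of_le_ne_top ENNReal.ofReal_ne_top hK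
  set g := G.toReal with hg
  set p := P.toReal with hp
  set κ := (profileK φ).toReal with hκ
  have hg0 : 0 ≤ g := ENNReal.toReal_nonneg
  have hp0 : 0 ≤ p := ENNReal.toReal_nonneg
  have hκ0 : 0 ≤ κ := ENNReal.toReal_nonneg
  have hGe : G = ENNReal.ofReal g := (ENNReal.ofReal_toReal hGtop).symm
  have hPe : P = ENNReal.ofReal p := (ENNReal.ofReal_toReal hPtop).symm
  have hKe : profileK φ = ENNReal.ofReal κ := (ENNReal.ofReal_toReal hKtop).symm
  have hgp : 2 * g + p ≤ E := by
    have h2G : (2 * G) ≠ ⊤ := ENNReal.mul_ne_top ENNReal.ofNat_ne_top hGtop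
    have := ENNReal.toReal_le_of_le_ofReal hE0 hGP'
    rwa [ENNReal.toReal_add h2G hPtop, ENNReal.toReal_mul, ENNReal.toReal_ofNat] at this
  have hκK : κ ≤ K := ENNReal.toReal_le_of_le_ofReal hK0 hK
  have hL3e : (ENNReal.ofReal L ^ 3)⁻¹ = ENNReal.ofReal ((L ^ 3)⁻¹) := by
    rw [← ENNReal.ofReal_pow hL.le, ENNReal.ofReal_inv_of_pos hL3]
  have hL3i : 0 ≤ (L ^ 3)⁻¹ := inv_nonneg.mpr hL3.le
  -- Step 1: the three families of terms, each bounded by a real number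
  have hT1 : ∀ k : Fin N, ∀ l ∈ univ.erase k,
      (ENNReal.ofReal L ^ 3)⁻¹ * G * jastrowNormSq L φ (univ.erase k) ≤
        ENNReal.ofReal ((L ^ 3)⁻¹ * g * (D * ν)) := by
    intro k l _
    rw [hL3e, hGe, ← ENNReal.ofReal_mul hL3i, ENNReal.ofReal_mul (mul_nonneg hL3i hg0)]
    exact mul_le_mul' le_rfl (hn1 k)
  have hT2 : ∀ k : Fin N, ∀ i ∈ univ.erase k, ∀ j ∈ (univ.erase k).erase i,
      (ENNReal.ofReal L ^ 3)⁻¹ * profileK φ * ((ENNReal.ofReal L ^ 3)⁻¹ * profileK φ *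
          jastrowNormSq L φ ((univ.erase i).erase j)) ≤
        ENNReal.ofReal ((L ^ 3)⁻¹ * κ * ((L ^ 3)⁻¹ * κ * (D ^ 2 * ν))) := by
    intro k i _ j hj
    have hji : j ≠ i := ne_of_mem_erase hj
    rw [hL3e, hKe, ← ENNReal.ofReal_mul hL3i,
      ENNReal.ofReal_mul (mul_nonneg hL3i hκ0), ENNReal.ofReal_mul (mul_nonneg hL3i hκ0)]
    exact mul_le_mul' le_rfl (mul_le_mul' le_rfl (hn2 i j hji))
  have hT3 : ∀ i : Fin N, ∀ j ∈ univ.filter (i < ·),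
      (ENNReal.ofReal L ^ 3)⁻¹ * P * jastrowNormSq L φ (univ.erase i) ≤
        ENNReal.ofReal ((L ^ 3)⁻¹ * p * (D * ν)) := by
    intro i j _
    rw [hL3e, hPe, ← ENNReal.ofReal_mul hL3i, ENNReal.ofReal_mul (mul_nonneg hL3i hp0)]
    exact mul_le_mul' le_rfl (hn1 i)
  -- Step 2: sum them
  have hr1 : 0 ≤ (L ^ 3)⁻¹ * g * (D * ν) := by positivity
  have hr2 : 0 ≤ (L ^ 3)⁻¹ * κ * ((L ^ 3)⁻¹ * κ * (D ^ 2 * ν)) := by positivity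
  have hr3 : 0 ≤ (L ^ 3)⁻¹ * p * (D * ν) := by positivity
  have hNNr : 0 ≤ (N : ℝ) * ((N : ℝ) - 1) := mul_nonneg (Nat.cast_nonneg _) (by linarith)
  have hNNNr : 0 ≤ (N : ℝ) * ((N : ℝ) - 1) * ((N : ℝ) - 2) := mul_nonneg hNNr (by linarith)
  have hNN1 : ((N : ℝ≥0∞) * ((N - 1 : ℕ) : ℝ≥0∞)) = ENNReal.ofReal ((N : ℝ) * ((N : ℝ) - 1)) := by
    rw [← ENNReal.ofReal_natCast, ← ENNReal.ofReal_natCast, Nat.cast_sub hN1, Nat.cast_one,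
      ← ENNReal.ofReal_mul (Nat.cast_nonneg _)]
  have hNN2 : ((N : ℝ≥0∞) * ((N - 1 : ℕ) : ℝ≥0∞) * ((N - 2 : ℕ) : ℝ≥0∞)) =
      ENNReal.ofReal ((N : ℝ) * ((N : ℝ) - 1) * ((N : ℝ) - 2)) := by
    rw [hNN1, ← ENNReal.ofReal_natCast, Nat.cast_sub hN, Nat.cast_ofNat,
      ← ENNReal.ofReal_mul hNNr]
  have hkin : ∫⁻ X in cellN N L, kineticDensity (jastrowC L φ) X ≤
      ENNReal.ofReal ((N : ℝ) * ((N : ℝ) - 1) * ((L ^ 3)⁻¹ * g * (D * ν)) +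
        (N : ℝ) * ((N : ℝ) - 1) * ((N : ℝ) - 2) *
          ((L ^ 3)⁻¹ * κ * ((L ^ 3)⁻¹ * κ * (D ^ 2 * ν)))) := by
    refine (hφ.lintegral_kinetic_le hL hbL).trans ?_
    rw [ENNReal.ofReal_add (mul_nonneg hNNr hr1) (mul_nonneg hNNNr hr2)]
    refine add_le_add ?_ ?_
    · calc _ ≤ ∑ k : Fin N, ∑ _l ∈ univ.erase k, ENNReal.ofReal ((L ^ 3)⁻¹ * g * (D * ν)) :=
            sum_le_sum fun k _ => sum_le_sum fun l hl => hT1 k l hl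
        _ = _ := by rw [sum_erase_const, hNN1, ← ENNReal.ofReal_mul hNNr]
    · calc _ ≤ ∑ k : Fin N, ∑ i ∈ univ.erase k, ∑ _j ∈ (univ.erase k).erase i,
            ENNReal.ofReal ((L ^ 3)⁻¹ * κ * ((L ^ 3)⁻¹ * κ * (D ^ 2 * ν))) :=
            sum_le_sum fun k _ => sum_le_sum fun i hi => sum_le_sum fun j hj => hT2 k i hi j hj
        _ = _ := by rw [sum_erase_erase_const, hNN2, ← ENNReal.ofReal_mul hNNNr]
  have hpot : ∫⁻ X in cellN N L, periodicInteraction v L X * ENNReal.ofReal (jastrow L φ univ X ^ 2) ≤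
      ENNReal.ofReal ((N : ℝ) * ((N : ℝ) - 1) / 2 * ((L ^ 3)⁻¹ * p * (D * ν))) := by
    refine (hφ.lintegral_potential_le hL hbL hv).trans ?_
    calc _ ≤ ∑ i : Fin N, ∑ _j ∈ univ.filter (i < ·), ENNReal.ofReal ((L ^ 3)⁻¹ * p * (D * ν)) :=
          sum_le_sum fun i _ => sum_le_sum fun j hj => hT3 i j hj
      _ = _ := by rw [sum_filter_lt_const hN1, ← ENNReal.ofReal_mul (div_nonneg hNNr zero_le_two)]
  -- Step 3: the energy of the normalised trial state
  set A : ℝ := (N : ℝ) * ((N : ℝ) - 1) * ((L ^ 3)⁻¹ * g * (D * ν)) +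
      (N : ℝ) * ((N : ℝ) - 1) * ((N : ℝ) - 2) * ((L ^ 3)⁻¹ * κ * ((L ^ 3)⁻¹ * κ * (D ^ 2 * ν))) +
      (N : ℝ) * ((N : ℝ) - 1) / 2 * ((L ^ 3)⁻¹ * p * (D * ν)) with hA
  have hA1 : 0 ≤ (N : ℝ) * ((N : ℝ) - 1) * ((L ^ 3)⁻¹ * g * (D * ν)) +
      (N : ℝ) * ((N : ℝ) - 1) * ((N : ℝ) - 2) * ((L ^ 3)⁻¹ * κ * ((L ^ 3)⁻¹ * κ * (D ^ 2 * ν))) :=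
    add_nonneg (mul_nonneg hNNr hr1) (mul_nonneg hNNNr hr2)
  have hA2 : 0 ≤ (N : ℝ) * ((N : ℝ) - 1) / 2 * ((L ^ 3)⁻¹ * p * (D * ν)) :=
    mul_nonneg (div_nonneg hNNr zero_le_two) hr3
  set Ψt := hφ.trialState hL hbL hν0 with hΨt
  have htot : periodicEnergy v Ψt ≤ ENNReal.ofReal (ν⁻¹ * A) := by
    rw [hΨt, hφ.periodicEnergy_trialState hL hbL hν0 v,
      ENNReal.ofReal_mul (inv_nonneg.mpr hν0.le)]
    refine mul_le_mul' le_rfl ?_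
    rw [lintegral_add_left (kineticDensity_measurable _), hA, ENNReal.ofReal_add hA1 hA2]
    exact add_le_add hkin hpot
  -- Step 4: the algebra `ν⁻¹ A ≤ N(N-1)/2 · E/(L³-(N-1)I) + N(N-1)(N-2) K²/(L³-(N-1)I)²`
  have hB : ν⁻¹ * A = (N : ℝ) * ((N : ℝ) - 1) / 2 * (2 * g + p) / (L ^ 3 - ((N : ℝ) - 1) * I) +
      (N : ℝ) * ((N : ℝ) - 1) * ((N : ℝ) - 2) * κ ^ 2 / (L ^ 3 - ((N : ℝ) - 1) * I) ^ 2 := by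
    rw [hA, hD]
    field_simp
    ring
  have hNN : 0 ≤ (N : ℝ) * ((N : ℝ) - 1) := by nlinarith
  have hfin : ν⁻¹ * A ≤ (N : ℝ) * ((N : ℝ) - 1) / 2 * E / (L ^ 3 - ((N : ℝ) - 1) * I) +
      (N : ℝ) * ((N : ℝ) - 1) * ((N : ℝ) - 2) * K ^ 2 / (L ^ 3 - ((N : ℝ) - 1) * I) ^ 2 := by
    rw [hB]
    refine add_le_add ?_ ?_
    · refine div_le_div_of_nonneg_right ?_ hden.le
      exact mul_le_mul_of_nonneg_left hgp (by positivity)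
    · refine div_le_div_of_nonneg_right ?_ (by positivity)
      exact mul_le_mul_of_nonneg_left (pow_le_pow_left₀ hκ0 hκK 2) (by nlinarith)
  exact htot.trans (ENNReal.ofReal_le_ofReal hfin)

/-- **The product-state bound for the Jastrow infimum**: under the hypotheses of
`LSSY2005_jastrowBound` (there `(N-1)I' < L³` also makes `Ψ_φ` normalisable),
`E_J(N, L) ≤ N(N-1)/2 · E/(L³-(N-1)I') + N(N-1)(N-2) K'²/(L³-(N-1)I')²`.
[cite: LSSY2005, Thm. 2.2, proof, (2.19)–(2.31)] -/
theorem jastrowGroundStateEnergy_le_pairBound {v : ℝ → ℝ≥0∞} (hv : Measurable v) {N : ℕ}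
    {L b : ℝ} (hN : 2 ≤ N) (hL : 0 < L) (hbL : 2 * b < L) {φ : Space → ℝ}
    (hφ : IsPairProfile b φ) {E I K : ℝ} (hE0 : 0 ≤ E) (hI0 : 0 ≤ I) (hK0 : 0 ≤ K)
    (hE : profileEnergy v φ ≤ ENNReal.ofReal E) (hI : profileDefect φ ≤ ENNReal.ofReal I)
    (hK : profileK φ ≤ ENNReal.ofReal K) (hNI : ((N : ℝ) - 1) * I < L ^ 3) :
    jastrowGroundStateEnergy v N L ≤ ENNReal.ofReal
      (N * ((N : ℝ) - 1) / 2 * E / (L ^ 3 - ((N : ℝ) - 1) * I) +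
        N * ((N : ℝ) - 1) * ((N : ℝ) - 2) * K ^ 2 / (L ^ 3 - ((N : ℝ) - 1) * I) ^ 2) :=
  (jastrowGroundStateEnergy_le v hφ hL hbL (hφ.jastrowNormR_pos hL hbL hI0 hI hNI _)).trans
    (hφ.periodicEnergy_trialState_le hv hN hL hbL hE0 hI0 hK0 hE hI hK hNI _)

-- Remark (not restated as a theorem, to keep a single discharge of the named fact in the tree):
-- `LSSY2005_jastrowBound` is the composite of `periodicGroundStateEnergy_le_jastrowGroundStateEnergy`
-- and `jastrowGroundStateEnergy_le_pairBound` (its hypothesis `0 < b` is not needed).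

end PairBound

/-! ### The Dyson–LSSY leading-order bound for the Jastrow infimum -/

section LeadingOrder

/-- Steps 1 and 2 combined at cut-off radius `β` and slack `ε → 0`, for `a > 0`, for the Jastrow
infimum: `E_J(N,L) ≤ N(N-1)/2 · (8πa/(1-a/β))/(L³ - (N-1)16πaβ²) +
N(N-1)(N-2)(16πaβ)²/(L³-(N-1)16πaβ²)²` whenever `β ≥ b₀(v)`, `2β < L` and `(N-1)16πaβ² < L³`
(as `periodicGroundStateEnergy_le_jastrow`, with `jastrowGroundStateEnergy_le_pairBound` for
step 2). [cite: LSSY2005, Thm. 2.2, proof, (2.28)–(2.32)] -/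
theorem jastrowGroundStateEnergy_le_dyson {v : ℝ → ℝ≥0∞} (hv : Measurable v) {b₀ : ℝ}
    (hab₀ : (scatteringLength v).toReal < b₀)
    (hA : ∀ (b ε : ℝ), b₀ ≤ b → 0 < ε →
      ∃ φ : Space → ℝ, IsPairProfile b φ ∧
        profileEnergy v φ ≤ ENNReal.ofReal
          (8 * Real.pi * (scatteringLength v).toReal / (1 - (scatteringLength v).toReal / b) + ε) ∧
        profileDefect φ ≤ ENNReal.ofReal (16 * Real.pi * (scatteringLength v).toReal * b ^ 2) ∧
        profileK φ ≤ ENNReal.ofReal (16 * Real.pi * (scatteringLength v).toReal * b))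
    {N : ℕ} {L β : ℝ} (hN : 2 ≤ N) (hL : 0 < L) (hβ₀ : b₀ ≤ β) (hβL : 2 * β < L)
    (hI : ((N : ℝ) - 1) * (16 * Real.pi * (scatteringLength v).toReal * β ^ 2) < L ^ 3) :
    jastrowGroundStateEnergy v N L ≤ ENNReal.ofReal
      (N * ((N : ℝ) - 1) / 2 *
          (8 * Real.pi * (scatteringLength v).toReal / (1 - (scatteringLength v).toReal / β)) /
          (L ^ 3 - ((N : ℝ) - 1) * (16 * Real.pi * (scatteringLength v).toReal * β ^ 2)) +
        N * ((N : ℝ) - 1) * ((N : ℝ) - 2) *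
          (16 * Real.pi * (scatteringLength v).toReal * β) ^ 2 /
          (L ^ 3 - ((N : ℝ) - 1) * (16 * Real.pi * (scatteringLength v).toReal * β ^ 2)) ^ 2) := by
  set a := (scatteringLength v).toReal with ha_def
  set n₁ : ℝ := (N : ℝ) - 1 with hn₁
  set E₀ : ℝ := 8 * Real.pi * a / (1 - a / β)
  set I₀ : ℝ := 16 * Real.pi * a * β ^ 2
  set K₀ : ℝ := 16 * Real.pi * a * β
  -- the bound as a function of the slack `ε`
  set G : ℝ → ℝ := fun ε =>
    N * n₁ / 2 * (E₀ + ε) / (L ^ 3 - n₁ * I₀) +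
      N * n₁ * ((N : ℝ) - 2) * K₀ ^ 2 / (L ^ 3 - n₁ * I₀) ^ 2 with hG
  have ha0 : 0 ≤ a := ENNReal.toReal_nonneg
  have hβ : 0 < β := by linarith
  have haβ : a < β := by linarith
  have haβ1 : a / β < 1 := (div_lt_one hβ).mpr haβ
  have hE₀ : 0 ≤ E₀ := div_nonneg (by positivity) (by linarith)
  have hI₀ : 0 ≤ I₀ := by positivity
  have hK₀ : 0 ≤ K₀ := by positivity
  -- for every `ε > 0`, steps 1 and 2 give `E_J(N,L) ≤ G ε`
  have hev : ∀ᶠ ε in 𝓝[>] (0 : ℝ), jastrowGroundStateEnergy v N L ≤ ENNReal.ofReal (G ε) := by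
    filter_upwards [eventually_mem_nhdsWithin] with ε hε
    rw [Set.mem_Ioi] at hε
    obtain ⟨φ, hφ, hφE, hφI, hφK⟩ := hA β ε hβ₀ hε
    simpa only [hG] using jastrowGroundStateEnergy_le_pairBound (E := E₀ + ε) (I := I₀) (K := K₀)
      hv hN hL hβL hφ (by positivity) hI₀ hK₀ hφE hφI hφK hI
  -- `G` is continuous at `0`
  have hlim : Tendsto G (𝓝[>] 0) (𝓝 (G 0)) := by
    refine Tendsto.mono_left ?_ nhdsWithin_le_nhds
    simp only [hG]
    exact Continuous.tendsto (by fun_prop) 0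
  simpa [hG] using ge_of_tendsto (ENNReal.tendsto_ofReal hlim) hev

/-- **LSSY Theorem 2.2 (2.14) for the Jastrow infimum** (Dyson's upper bound, symmetric
product state). Let `v ≥ 0` be measurable of finite range with scattering length `a < ∞`, and put
`ρ₁ = (N-1)/L³`, `b = (4πρ₁/3)^{-1/3}`. There are `C, c > 0` (`C = 12`, `c = c(v)`) such that
for `N ≥ 2`, `L > 0` and `a/b ≤ c`,
`E_J(N, L) ≤ 4πρ₁a(1 + C a/b) N`:
the printed proof of (2.14) bounds the energy `⟨Ψ,HΨ⟩/⟨Ψ,Ψ⟩` of the product trial state, hence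
the infimum over the pair-product manifold and not only `E₀^per(N,L)` (cf. BastiEtAl2026
(1.10)–(1.11) for the symmetric product). Proof: the profile of App. C
(`LSSY2005_dysonProfile_holds`, with `LSSY2005_zeroScatteringLength_holds` for `a = 0`, where
`φ ≡ 1` gives `E_J = 0`), the pair bound `jastrowGroundStateEnergy_le_pairBound` at cut-off `b/4`,
and the optimisation `jastrow_optimisation`; no range condition on `L` is needed (the interaction
is the full lattice sum `v^per`). [cite: LSSY2005, Thm. 2.2 (2.14)] -/
theorem jastrowGroundStateEnergy_le_leadingOrder {v : ℝ → ℝ≥0∞} {R₀ : ℝ} (hv : Measurable v)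
    (hR : ∀ r, R₀ < r → v r = 0) (ha : scatteringLength v ≠ ⊤) :
    ∃ C c : ℝ, 0 < C ∧ 0 < c ∧
      ∀ (N : ℕ) (L : ℝ), 2 ≤ N → 0 < L →
        (scatteringLength v).toReal /
            (4 * Real.pi * (((N : ℝ) - 1) / L ^ 3) / 3) ^ (-(1 : ℝ) / 3) ≤ c →
        jastrowGroundStateEnergy v N L ≤ ENNReal.ofReal
          (4 * Real.pi * (((N : ℝ) - 1) / L ^ 3) * (scatteringLength v).toReal *
            (1 + C * ((scatteringLength v).toReal /
              (4 * Real.pi * (((N : ℝ) - 1) / L ^ 3) / 3) ^ (-(1 : ℝ) / 3))) * N) := by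
  rcases eq_or_ne (scatteringLength v) 0 with ha0 | ha0
  · -- the free case `a = 0`: `v = 0` a.e., the profile `φ ≡ 1` has `E₁ = I = K = 0`
    have hv0 : ∀ᵐ x : Space, v ‖x‖ = 0 := LSSY2005_zeroScatteringLength_holds v R₀ hv hR ha0
    refine ⟨1, 1, one_pos, one_pos, fun N L hN hL _ => ?_⟩
    have hβL : 2 * (L / 4) < L := by linarith
    have h := jastrowGroundStateEnergy_le_pairBound (E := 0) (I := 0) (K := 0) hv hN hL hβL
      (isPairProfile_one _) le_rfl le_rfl le_rfl
      (by rw [profileEnergy_one_eq_zero hv0]; exact bot_le) (by simp) (by simp)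
      (by simp only [mul_zero]; positivity)
    have h0 : jastrowGroundStateEnergy v N L = 0 := by simpa using h
    simp [ha0, h0]
  · -- `a > 0`
    have ha0 : 0 < scatteringLength v := pos_iff_ne_zero.mpr ha0
    set a := (scatteringLength v).toReal with ha_def
    have ha0' : 0 < a := ENNReal.toReal_pos ha0.ne' ha
    obtain ⟨b₀, hab₀, hA'⟩ := LSSY2005_dysonProfile_holds v R₀ hv hR ha ha0
    have hb₀ : 0 < b₀ := ha0'.trans hab₀
    refine ⟨12, min (1 / 16) (a / (4 * b₀)), by norm_num, lt_min (by norm_num) (by positivity),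
      fun N L hN hL hab => ?_⟩
    set b : ℝ := (4 * Real.pi * (((N : ℝ) - 1) / L ^ 3) / 3) ^ (-(1 : ℝ) / 3) with hb_def
    have hN' : (2 : ℝ) ≤ N := by exact_mod_cast hN
    have hn₁ : (1 : ℝ) ≤ (N : ℝ) - 1 := by linarith
    have ht : 0 < 4 * Real.pi * (((N : ℝ) - 1) / L ^ 3) / 3 := by positivity
    have hb0 : 0 < b := Real.rpow_pos_of_pos ht _
    have hb3 : 4 * Real.pi * ((N : ℝ) - 1) * b ^ 3 = 3 * L ^ 3 := by
      have h3 : b ^ 3 = (4 * Real.pi * (((N : ℝ) - 1) / L ^ 3) / 3)⁻¹ := by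
        rw [hb_def, ← Real.rpow_natCast, ← Real.rpow_mul ht.le]
        norm_num
        rw [Real.rpow_neg_one, inv_div]
      rw [h3]
      field_simp
    have hx : a / b ≤ 1 / 16 := hab.trans (min_le_left _ _)
    have hb4 : b₀ ≤ b / 4 := by
      have h := hab.trans (min_le_right _ _)
      rw [div_le_div_iff_of_pos_left ha0' hb0 (by positivity)] at h
      linarith
    have hbL : b < L := by
      refine lt_of_pow_lt_pow_left₀ 3 hL.le ?_
      have hL3 : 0 < L ^ 3 := by positivity
      have hb3' : 0 < b ^ 3 := by positivity
      have h1 : b ^ 3 ≤ ((N : ℝ) - 1) * b ^ 3 := le_mul_of_one_le_left hb3'.le hn₁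
      have h2 : 4 * Real.pi * b ^ 3 ≤ 4 * Real.pi * (((N : ℝ) - 1) * b ^ 3) :=
        mul_le_mul_of_nonneg_left h1 (by positivity)
      have h3 : 4 * 2 * b ^ 3 ≤ 4 * Real.pi * b ^ 3 := by
        have := Real.two_le_pi
        gcongr
      nlinarith
    have hβL : 2 * (b / 4) < L := by linarith
    have hI : ((N : ℝ) - 1) * (16 * Real.pi * a * (b / 4) ^ 2) < L ^ 3 := by
      have h' : ((N : ℝ) - 1) * (16 * Real.pi * a * (b / 4) ^ 2) =
          4 * Real.pi * ((N : ℝ) - 1) * b ^ 3 * (a / b) / 4 := by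
        field_simp
        ring
      rw [h', hb3]
      have hL3 : 0 < L ^ 3 := by positivity
      nlinarith
    exact (jastrowGroundStateEnergy_le_dyson hv hab₀ hA' hN hL hb4 hβL hI).trans
      (ENNReal.ofReal_le_ofReal (jastrow_optimisation hN' ha0' hb0 hx hb3))

/-- **Non-vacuity**: in the regime of `jastrowGroundStateEnergy_le_leadingOrder` the Jastrow
infimum is finite. [cite: LSSY2005, Thm. 2.2 (2.14)] -/
theorem jastrowGroundStateEnergy_lt_top {v : ℝ → ℝ≥0∞} {R₀ : ℝ} (hv : Measurable v)
    (hR : ∀ r, R₀ < r → v r = 0) (ha : scatteringLength v ≠ ⊤) :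
    ∃ c : ℝ, 0 < c ∧ ∀ (N : ℕ) (L : ℝ), 2 ≤ N → 0 < L →
      (scatteringLength v).toReal /
          (4 * Real.pi * (((N : ℝ) - 1) / L ^ 3) / 3) ^ (-(1 : ℝ) / 3) ≤ c →
      jastrowGroundStateEnergy v N L < ⊤ := by
  obtain ⟨C, c, -, hc, h⟩ := jastrowGroundStateEnergy_le_leadingOrder hv hR ha
  exact ⟨c, hc, fun N L hN hL hab => (h N L hN hL hab).trans_lt ENNReal.ofReal_lt_top⟩

/-- **Sanity check (free gas)**: without interaction the Jastrow infimum vanishes,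
`E_J(N, L) = 0` for `N ≥ 2`, `L > 0` (the constant profile `φ ≡ 1` is in the manifold; formally
the case `a = 0` of `jastrowGroundStateEnergy_le_leadingOrder`). [folklore] -/
theorem jastrowGroundStateEnergy_zero_interaction {N : ℕ} {L : ℝ} (hN : 2 ≤ N) (hL : 0 < L) :
    jastrowGroundStateEnergy 0 N L = 0 := by
  have h0 : scatteringLength 0 = 0 := scatteringLength_zero
  obtain ⟨C, c, -, hc, h⟩ := jastrowGroundStateEnergy_le_leadingOrder (v := 0) (R₀ := 0)
    measurable_const (fun _ _ => rfl) (by rw [h0]; exact ENNReal.zero_ne_top)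
  have h1 := h N L hN hL (by rw [h0, ENNReal.toReal_zero, zero_div]; exact hc.le)
  simpa [h0] using h1

end LeadingOrder

end Literature.MathematicalPhysics.QuantumManyBody.BoseGas

end
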